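import Summits.BirchSwinnertonDyer.BirchSwinnertonDyer.Theorems.SignedLowerHalvesKobayashiMainConjectureSmallImageParityStratumExact
import Summits.BirchSwinnertonDyer.BirchSwinnertonDyer.Theorems.SignedLowerHalvesKobayashiMainConjectureSmallImageKatoIntegralOfMu
import Summits.BirchSwinnertonDyer.BirchSwinnertonDyer.Theses.SignedLowerHalves
import HarnessLib

/-!
# Route `SignedLowerHalves` (K3), crux 4 `KobayashiMainConjectureSmallImage` (item stmt-BirchSwinnertonDyer-19002):
# the crux BY NAME from its OFF-STRATUM part and the ON-STRATUM `μ`-part, modulo PRINT ONLY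
# (the exact reading: no Conjecture A, no ζ-package, no Kato integrality)

Cell `bsd-ssimc`, seat `bsd-line-slh-p3` LEAD gen 12 (helper file `--supports stmt-BirchSwinnertonDyer-19002`; CALIBRATION /
SUPPORT ONLY). Companion of `…SmallImageParityStratumExact.lean` (route-independent: on the `(0, ≤ 1)`-stratum
`KobayashiMainConjecture W p ε ⟺ μ^ε = 0` modulo `h12 h41 h5 h3 hpar`) and of `…SmallImageParityStratum.lean` (the
Conjecture-A version). HONEST FRAMING: crux 4 is OPEN; this file only REDISTRIBUTES its content; every theorem is
CONDITIONAL on displayed published binders (Kobayashi 2003 Thm. 1.2 `h12`, Thm. 4.1 `h41` — rational display only —,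
the period units `h5 h3`, `p`-parity `hpar`) and on the two displayed PARTS of the item; BSD / crux 4 NOT proved.

## What is proved

* `kobayashiMainConjectureSmallImage_of_offStratum_of_muStratum` — `Theses.SignedLowerHalves.KobayashiMainConjectureSmallImage`
  ⟸ `h12 h41 h5 h3` ∧ `hpar` ∧ (ON) «at every X7 ∧ ¬CM ∧ `a_p = 0` ∧ ¬Surj pair at odd `p`, for every sign `ε` whose
  `L_p^ε` (newform of level `N_E`) has `(μ, λ) = (0, ≤ 1)`, every characteristic power series of every key-`γ` signed
  dual datum has `μ = 0`» ∧ (OFF) «at every such pair with BOTH signs off the stratum (`λ ≥ 2` whenever `μ = 0`),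
  `∃ ε, KobayashiMainConjecture W p ε`».
* `offStratum_of_kobayashiMainConjectureSmallImage` — the converse for the OFF part (trivial).
* §2 (appended) `kobayashiMainConjectureSmallImage_of_lower_of_mu` — crux 4 BY NAME ⟸ `h12 h41 h5 h3` ∧ «at every pair
  of the domain SOME sign `ε` has the Eisenstein half `KobayashiLowerDivisibility W p ε` AND `μ^ε = 0`» (no parity, no
  stratum, no Conjecture A, no ζ-package: `SmallImageKatoIntegralOfMu.kobayashiMainConjecture_of_lowerDivisibility_of_mu_eq_zero`,
  Kato's Thm. 4.1 made integral by `μ`) — the minimal form of what the line `birth_acns` composes.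
READING for the planner (D-0014): modulo print, item 19002 = (ON) Kobayashi's `μ^ε = 0` at the certified signs —
a `μ`-statement with NO engine content, implied by Coates–Sujatha's Conjecture A (`…SmallImageParityStratum`) —
plus (OFF) the main conjecture at the small-image pairs where both signed `p`-adic `L`-functions have `λ ≥ 2` or
`μ ≥ 1`: the children 23115 / 23116 (engines), 23117 (analytic rider) and 23118 (`λ`-part at 3) are needed ONLY off
the stratum.

References: [Kobayashi2003] Thm. 1.2, Thm. 4.1, Thm. 1.4, Conjecture (p. 2); [DokchitserDokchitserAnnals2010] Thm. 1.4;
[Sprung2017] Cor. 4.14; [Pollack2003] Prop. 6.18; [GreenbergVatsal2000] p. 4; [CoatesSujatha2005] Conjecture A.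
-/

set_option autoImplicit false
set_option linter.dupNamespace false

noncomputable section

open scoped Classical MatrixGroups ModularForm

open CongruenceSubgroup PowerSeries WeierstrassCurve Field Literature.NumberTheory.EllipticCurves
  Literature.NumberTheory.EllipticCurves.ModularForms
  Literature.NumberTheory.EllipticCurves.Rank1Residual Literature.NumberTheory.EllipticCurves.Sprung2017
  Literature.NumberTheory.EllipticCurves.Kobayashi2003 ZpExtension
  Literature.NumberTheory.EllipticCurves.Rank1Residual.Typed
  Summit.BirchSwinnertonDyer.Rank1Residual.X1.MuLambda
  Summit.BirchSwinnertonDyer.Rank1Residual.Supersingular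

namespace Summit.BirchSwinnertonDyer.BirchSwinnertonDyer.Theorems.SmallImageParityStratumExact

/-- **Crux 4 BY NAME from its OFF-stratum part and its ON-stratum `μ`-part, modulo print.** Hypotheses BY NAME: `h12`
(Kobayashi Thm. 1.2), `h41` (Thm. 4.1; only the image-free rational display is used), `h5`/`h3` (period units),
`hpar` (`p`-parity at every `(W, p)`); `hon` — the ON-STRATUM `μ`-PART: on the crux's domain, for every sign `ε`
certified `(μ, λ)(L_p^ε) = (0, ≤ 1)` (newform of level `N_E`), `μ(ξ^ε) = 0` for every characteristic power series
of every key-`γ` signed dual datum; `hoff` — the OFF-STRATUM PART: on the domain, when both signs are off the stratum,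
`∃ ε, KobayashiMainConjecture W p ε`. Conclusion: `Theses.SignedLowerHalves.KobayashiMainConjectureSmallImage`.
Proof: on the stratum `kobayashiMainConjecture_of_lam_le_one_of_mu_eq_zero` (exact form: `char X^ε = (p^k ϖ L_p^ε)`
by parity + Kato-rational + `Λ`-algebra, `μ = 0` forces `k = 0`); off it `hoff`; no newform of level `N_E`: the
main conjecture is vacuous. CALIBRATION ONLY.
[cite: Kobayashi2003, Thm. 1.2, Thm. 4.1, Thm. 1.4 and Conjecture (p. 2)] [cite: DokchitserDokchitserAnnals2010, Thm. 1.4]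
[cite: GreenbergVatsal2000, p. 4] [cite: Pollack2003, Prop. 6.18] -/
theorem kobayashiMainConjectureSmallImage_of_offStratum_of_muStratum
    (h12 : Kobayashi2003.thm12_signedSelmerDual_finite_torsion)
    (h41 : Kobayashi2003.thm41_signedCharIdeal_divisibility)
    (h5 : realPeriodRat_eq_unit_mul_plusPeriod) (h3 : realPeriodRat_eq_unit_mul_plusPeriod_three)
    (hpar : ∀ (W : WeierstrassCurve ℚ) [W.IsElliptic] (p : ℕ) [Fact p.Prime], p_parity W p)
    (hon : ∀ (W : WeierstrassCurve ℚ) [W.IsElliptic] [W.IsGloballyMinimal] (p : ℕ) [Fact p.Prime],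
      p ≠ 2 → ClassX7 W p → ¬ W.HasCM → W.frobeniusTrace p = 0 → ¬ Surj W p →
      ∀ [NeZero (W.conductorNorm ℤ)] (f₀ : CuspForm (Gamma0 (W.conductorNorm ℤ)) 2), IsNewformOf W f₀ →
      ∀ (ε : ℤˣ), (∀ L : IwasawaAlgebra p, IsSignedPAdicLFunction f₀ p ε L → mu L = 0 ∧ lam L ≤ 1) →
      ∀ (κ : ZpExtension ℚ p) (γ : absoluteGaloisGroup ℚ), κ.IsCyclotomic → κ.IsTopGenerator γ →
        IsCyclotomicVariable p γ → ∀ (D : SignedSelmerDualData W κ γ ε) (ξ : IwasawaAlgebra p),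
          D.charIdeal = Ideal.span {ξ} → mu ξ = 0)
    (hoff : ∀ (W : WeierstrassCurve ℚ) [W.IsElliptic] [W.IsGloballyMinimal] (p : ℕ) [Fact p.Prime],
      p ≠ 2 → ClassX7 W p → ¬ W.HasCM → W.frobeniusTrace p = 0 → ¬ Surj W p →
      (∀ [NeZero (W.conductorNorm ℤ)] (f₀ : CuspForm (Gamma0 (W.conductorNorm ℤ)) 2),
        IsNewformOf W f₀ → ∀ (ε : ℤˣ) (L : IwasawaAlgebra p),
          IsSignedPAdicLFunction f₀ p ε L → mu L = 0 → 2 ≤ lam L) →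
      ∃ ε : ℤˣ, KobayashiMainConjecture W p ε) :
    Summit.BirchSwinnertonDyer.BirchSwinnertonDyer.Theses.SignedLowerHalves.KobayashiMainConjectureSmallImage := by
  intro W _ _ p _ hp hX hCM hap hs
  by_cases hmod : ∃ (_ : NeZero (W.conductorNorm ℤ)) (f₀ : CuspForm (Gamma0 (W.conductorNorm ℤ)) 2),
      IsNewformOf W f₀
  · obtain ⟨inst, f₀, hf₀⟩ := hmod
    by_cases hstr : ∃ ε : ℤˣ, ∀ L : IwasawaAlgebra p,
        IsSignedPAdicLFunction f₀ p ε L → mu L = 0 ∧ lam L ≤ 1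
    · -- on the stratum: the exact form + the `μ`-part
      obtain ⟨ε, hcert⟩ := hstr
      exact ⟨ε, kobayashiMainConjecture_of_lam_le_one_of_mu_eq_zero W p h12 h41 h5 h3 (hpar W p) hp hX.1.1 hap ε
        hf₀ hcert (hon W p hp hX hCM hap hs f₀ hf₀ ε hcert)⟩
    · -- off the stratum: `hoff`
      refine hoff W p hp hX hCM hap hs fun f₁ hf₁ ε L hL hμ ↦ ?_
      have hff : f₁ = f₀ := hf₁.unique hf₀
      subst hff
      by_contra hlt
      refine hstr ⟨ε, fun L' hL' ↦ ?_⟩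
      have hLL : L' = L := hL'.unique hL
      subst hLL
      exact ⟨hμ, by omega⟩
  · -- no newform of level `N_W`: the main conjecture (for any sign) is vacuous
    refine ⟨1, ?_⟩
    intro κ γ _ _ _ inst f hf
    exact absurd ⟨inst, f, hf⟩ hmod

/-- **The converse for the OFF part (trivial): crux 4 implies the main conjecture for some sign at every off-stratum
pair of its domain.** [cite: Kobayashi2003, Conjecture (p. 2)] -/
theorem offStratum_of_kobayashiMainConjectureSmallImage
    (h : Summit.BirchSwinnertonDyer.BirchSwinnertonDyer.Theses.SignedLowerHalves.KobayashiMainConjectureSmallImage) :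
    ∀ (W : WeierstrassCurve ℚ) [W.IsElliptic] [W.IsGloballyMinimal] (p : ℕ) [Fact p.Prime],
      p ≠ 2 → ClassX7 W p → ¬ W.HasCM → W.frobeniusTrace p = 0 → ¬ Surj W p →
      (∀ [NeZero (W.conductorNorm ℤ)] (f₀ : CuspForm (Gamma0 (W.conductorNorm ℤ)) 2),
        IsNewformOf W f₀ → ∀ (ε : ℤˣ) (L : IwasawaAlgebra p),
          IsSignedPAdicLFunction f₀ p ε L → mu L = 0 → 2 ≤ lam L) →
      ∃ ε : ℤˣ, KobayashiMainConjecture W p ε :=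
  fun W _ _ p _ hp hX hCM hap hs _ ↦ h W p hp hX hCM hap hs

/-- **The ON part is implied by the crux at the certified sign whenever that sign's main conjecture holds** — in
particular the crux's `∃ ε` witness, when it is a certified sign, has `μ^ε = 0`
(`mu_eq_zero_of_kobayashiMainConjecture_of_lam_le_one`). Recorded to make the decomposition's bookkeeping explicit; the
crux does not by itself give the `μ`-part at the OTHER sign. [cite: Kobayashi2003, Conjecture (p. 2) and Thm. 1.4] -/
theorem muStratum_of_kobayashiMainConjecture
    (h5 : realPeriodRat_eq_unit_mul_plusPeriod) (h3 : realPeriodRat_eq_unit_mul_plusPeriod_three)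
    (W : WeierstrassCurve ℚ) [W.IsElliptic] [W.IsGloballyMinimal] (p : ℕ) [Fact p.Prime]
    (hp : p ≠ 2) (hgood : W.HasGoodReductionAtPrime p) (hap : W.frobeniusTrace p = 0) (ε : ℤˣ)
    (hMC : KobayashiMainConjecture W p ε)
    [NeZero (W.conductorNorm ℤ)] {f₀ : CuspForm (Gamma0 (W.conductorNorm ℤ)) 2} (hf₀ : IsNewformOf W f₀)
    (hcert₀ : ∀ L : IwasawaAlgebra p, IsSignedPAdicLFunction f₀ p ε L → mu L = 0 ∧ lam L ≤ 1)
    {ϖ : ℚ} (hϖ : (ϖ : ℝ) * W.realPeriodRat = plusPeriod f₀)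
    {Lplus Lminus : IwasawaAlgebra p} (hPP : IsPollackPair f₀ p Lplus Lminus)
    (κ : ZpExtension ℚ p) (γ : absoluteGaloisGroup ℚ) (hκ : κ.IsCyclotomic) (hγ : κ.IsTopGenerator γ)
    (hγ' : IsCyclotomicVariable p γ) (D : SignedSelmerDualData W κ γ ε) (ξ : IwasawaAlgebra p)
    (hξ : D.charIdeal = Ideal.span {ξ}) : mu ξ = 0 :=
  mu_eq_zero_of_kobayashiMainConjecture_of_lam_le_one W p h5 h3 hp hgood hap ε hf₀ hcert₀ hMC κ γ hκ hγ hγ' ϖ hϖ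
    Lplus Lminus hPP D ξ hξ

/-! ## §2. Crux 4 BY NAME from «Eisenstein half ∧ `μ^ε = 0` for one sign» (appended) -/

/-- **Crux 4 BY NAME ⟸ prints ∧ «for every pair of the domain, SOME sign has the Eisenstein half AND `μ^ε = 0`».**
Hypotheses BY NAME: `h12` (Thm. 1.2), `h41` (Thm. 4.1, image-free display only), `h5`/`h3` (period units), and `hlowμ`:
at every X7 ∧ ¬CM ∧ `a_p = 0` ∧ ¬Surj pair at odd `p` there is a sign `ε` with `KobayashiLowerDivisibility W p ε` and
`μ(ξ^ε) = 0` for every characteristic power series of every key-`γ` signed dual datum. Conclusion: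
`Theses.SignedLowerHalves.KobayashiMainConjectureSmallImage` — by `SmallImageKatoIntegralOfMu.kobayashiMainConjecture_of_lowerDivisibility_of_mu_eq_zero`
(`p` is prime in `Λ`, so Kato's rational inclusion is integral once `μ^ε = 0`). This is the MINIMAL form of the line
`birth_acns`: its engines (children 23115/23116) produce the Eisenstein half rationally and its rider/saturation (23117,
BCS 4.2.2) the `μ`-statement; no parity, stratum, Conjecture A or ζ-package enters here. CALIBRATION ONLY.
[cite: Kobayashi2003, Thm. 1.2, Thm. 4.1 and Conjecture (p. 2)] [cite: Washington1997, §13.1] [cite: GreenbergVatsal2000, p. 4] -/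
theorem kobayashiMainConjectureSmallImage_of_lower_of_mu
    (h12 : Kobayashi2003.thm12_signedSelmerDual_finite_torsion)
    (h41 : Kobayashi2003.thm41_signedCharIdeal_divisibility)
    (h5 : realPeriodRat_eq_unit_mul_plusPeriod) (h3 : realPeriodRat_eq_unit_mul_plusPeriod_three)
    (hlowμ : ∀ (W : WeierstrassCurve ℚ) [W.IsElliptic] [W.IsGloballyMinimal] (p : ℕ) [Fact p.Prime],
      p ≠ 2 → ClassX7 W p → ¬ W.HasCM → W.frobeniusTrace p = 0 → ¬ Surj W p →
      ∃ ε : ℤˣ, KobayashiLowerDivisibility W p ε ∧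
        ∀ (κ : ZpExtension ℚ p) (γ : absoluteGaloisGroup ℚ), κ.IsCyclotomic → κ.IsTopGenerator γ →
          IsCyclotomicVariable p γ → ∀ (D : SignedSelmerDualData W κ γ ε) (ξ : IwasawaAlgebra p),
            D.charIdeal = Ideal.span {ξ} → mu ξ = 0) :
    Summit.BirchSwinnertonDyer.BirchSwinnertonDyer.Theses.SignedLowerHalves.KobayashiMainConjectureSmallImage := by
  intro W _ _ p _ hp hX hCM hap hs
  obtain ⟨ε, hlow, hμ⟩ := hlowμ W p hp hX hCM hap hs
  exact ⟨ε, SmallImageKatoIntegralOfMu.kobayashiMainConjecture_of_lowerDivisibility_of_mu_eq_zero W p h12 h41 h5 h3 hp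
    hX.1.1 hap hlow hμ⟩

end Summit.BirchSwinnertonDyer.BirchSwinnertonDyer.Theorems.SmallImageParityStratumExact

end
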